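import Summits.BirchSwinnertonDyer.BirchSwinnertonDyer.Theorems.AlignedTransportAtTwoMainConjectureOfRankZeroBSDAtTwoSelmerLayerGrowthDichotomy
import HarnessLib

/-!
# Route `AlignedTransportAtTwo`, crux C2 `MainConjectureOfRankZeroBSDAtTwo` (stmt-BirchSwinnertonDyer-22298):
# THE LAYER BUDGET — `rank_{ℤ_p} X/ω_nX = rank_{ℤ_p} X/TX + ∑_{m<n} rank_{ℤ_p} X/Ψ_{m+1}X` (telescoped layer split, every `p`,
# every number field, every `ℤ_p`-extension), hence `corank Sel_{p^∞}(E_{K_n}/K_n) ≤ rank X/TX + ∑_{m<n} rank X/Ψ_{m+1}X`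
# unconditionally, with equality modulo Greenberg's `ker g_n`; and every nonzero summand is a cyclotomic prime factor of `char_Λ X`

HONEST FRAMING (cell `bsd-f1-sign2`, WIDTH-5 attached prover seat `bsd-line-att-p5` gen 40 on line `birth` of the lead
`bsd-line-att-p2`; `--supports` stmt-BirchSwinnertonDyer-22298, closes nothing; BSD is NOT proved by any of this; the crux
C2, its verdict «blocked-on `Rank1Residual.GreenbergMuConjectureIrreducible`» and every registered stub are untouched).
THEOREMS ONLY — no `def`, no instance, no named fact, no `sorry`. Corollaries of `…SelmerLayerSplit` (the one-step split) and
`…SelmerLayerGrowthDichotomy` (`rank X/Ψ_{m+1}X > 0 ⟹ Ψ_{m+1} ∣ char_Λ X`), by induction on `n`: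

* ★★ `lambdaInvariant_layerQuotient_eq_coinvariantsRank_add_sum` — **`rank X/ω_nX = rank X/TX + ∑_{m<n} rank X/Ψ_{m+1}X`**;
* ★★ `selmerCorank_layer_le_coinvariantsRank_add_sum` (unconditional, Lemma 3.1) / ★★★ `selmerCorank_layer_eq_coinvariantsRank_add_sum_of_finite_kerG`
  — **`corank_{ℤ_p} Sel_{p^∞}(E_{K_n}/K_n) (≤ / =) rank X/TX + ∑_{m<n} rank X/Ψ_{m+1}X`**: the Ш-inclusive, layer-resolved form of the
  lineage's cyclotomic-layer rank budget (g36/g37: Mordell–Weil ranks, `#growth layers ≤ ord_p L_p(E,…)`);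
* ★★ `cyclotomicLayer_dvd_of_mem_charIdeal_of_summand_pos` — **each layer `m < n` with `rank X/Ψ_{m+1}X > 0` contributes the prime
  `Ψ_{m+1}` to `char_Λ X`** (so, modulo control, every layer where the Selmer corank grows costs a distinct cyclotomic factor of `f_X`).

References: R. Greenberg, LNM 1716 (1999), Thm. 1.2, Thm. 1.9, §3, §5 p. 132 [GreenbergLNM1716]; L. Washington, GTM 83, §13.2 [Washington1997].
-/

set_option linter.dupNamespace false
set_option autoImplicit false

noncomputable section

open scoped Classical AddSubgroup TensorProduct Polynomial

universe u

namespace Summit.BirchSwinnertonDyer.BirchSwinnertonDyer.Theorems.AlignedTransportAtTwoSelmerLayerBudget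

open Polynomial WeierstrassCurve Literature.NumberTheory.EllipticCurves Literature.NumberTheory.EllipticCurves.IwasawaDual
  Summit.BirchSwinnertonDyer.BirchSwinnertonDyer.Theorems.AlignedTransportAtTwoSelmerLayerModel
  Summit.BirchSwinnertonDyer.BirchSwinnertonDyer.Theorems.AlignedTransportAtTwoSelmerLayerDuality
  Summit.BirchSwinnertonDyer.BirchSwinnertonDyer.Theorems.AlignedTransportAtTwoSelmerLayerControl
  Summit.BirchSwinnertonDyer.BirchSwinnertonDyer.Theorems.AlignedTransportAtTwoSelmerLayerSplit
  Summit.BirchSwinnertonDyer.BirchSwinnertonDyer.Theorems.AlignedTransportAtTwoSelmerLayerGrowthDichotomy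

section Budget

variable {K : Type u} [Field K] [NumberField K] (W : WeierstrassCurve K) {p : ℕ} [hp : Fact p.Prime]
  (κ : ZpExtension K p) {γ : Field.absoluteGaloisGroup K}

/-- ★★ **THE LAYER BUDGET: `rank_{ℤ_p} X/ω_nX = rank_{ℤ_p} X/TX + ∑_{m<n} rank_{ℤ_p} X/Ψ_{m+1}X`** for every dual datum with `X` finitely
generated, every `n` (telescoping `…SelmerLayerSplit.lambdaInvariant_layerQuotient_succ_eq_add`; `ω_0 = T`). In structure-theory terms
`Λ/ω_n ∼ Λ/T ⊕ ⊕_{m<n} Λ/Ψ_{m+1}`, here without the structure theorem. [cite: Washington1997, §13.2] [cite: GreenbergLNM1716, §1 p. 65] -/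
theorem lambdaInvariant_layerQuotient_eq_coinvariantsRank_add_sum (hγ : κ.IsTopGenerator γ) (D : W.SelmerDualData κ γ)
    [Module.Finite (IwasawaAlgebra p) D.X] (n : ℕ) :
    lambdaInvariant p (D.X ⧸ (Ideal.span {((1 + PowerSeries.X : PowerSeries ℤ_[p]) ^ (p ^ n) - 1 : IwasawaAlgebra p)} •
        ⊤ : Submodule (IwasawaAlgebra p) D.X)) =
      IwasawaAlgebra.coinvariantsRank p D.X +
        ∑ m ∈ Finset.range n, lambdaInvariant p (D.X ⧸ (Ideal.span
          {(∑ i ∈ Finset.range p, ((1 + PowerSeries.X : PowerSeries ℤ_[p]) ^ (p ^ m)) ^ i : IwasawaAlgebra p)} •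
            ⊤ : Submodule (IwasawaAlgebra p) D.X)) := by
  induction n with
  | zero =>
    rw [Finset.sum_range_zero, add_zero]
    have e : Ideal.span {((1 + PowerSeries.X : PowerSeries ℤ_[p]) ^ (p ^ 0) - 1 : IwasawaAlgebra p)} •
        (⊤ : Submodule (IwasawaAlgebra p) D.X) = Ideal.span {(PowerSeries.X : IwasawaAlgebra p)} • ⊤ := by
      rw [pow_zero, pow_one, add_sub_cancel_left]
    rw [lambdaInvariant_eq_of_linearEquiv (Submodule.quotEquivOfEq _ _ e)]
    rfl
  | succ n ih => rw [lambdaInvariant_layerQuotient_succ_eq_add W κ hγ D n, ih, Finset.sum_range_succ, add_assoc]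

end Budget

section Control

variable {K : Type u} [Field K] [NumberField K] (W : WeierstrassCurve K) [W.IsElliptic] {p : ℕ} [hp : Fact p.Prime]
  (κ : ZpExtension K p) {γ : Field.absoluteGaloisGroup K}

/-- ★★ **`corank_{ℤ_p} Sel_{p^∞}(E_{K_n}/K_n) ≤ rank_{ℤ_p} X/TX + ∑_{m<n} rank_{ℤ_p} X/Ψ_{m+1}X` UNCONDITIONALLY** (Lemma 3.1 at layer `n`
and the budget). [cite: GreenbergLNM1716, §3 Lemma 3.1, Thm 1.9] -/
theorem selmerCorank_layer_le_coinvariantsRank_add_sum (hγ : κ.IsTopGenerator γ) (D : W.SelmerDualData κ γ)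
    [Module.Finite (IwasawaAlgebra p) D.X] (n : ℕ) :
    (W.baseChange (κ.layer n)).selmerCorank p ≤
      IwasawaAlgebra.coinvariantsRank p D.X +
        ∑ m ∈ Finset.range n, lambdaInvariant p (D.X ⧸ (Ideal.span
          {(∑ i ∈ Finset.range p, ((1 + PowerSeries.X : PowerSeries ℤ_[p]) ^ (p ^ m)) ^ i : IwasawaAlgebra p)} •
            ⊤ : Submodule (IwasawaAlgebra p) D.X)) := by
  rw [← lambdaInvariant_layerQuotient_eq_coinvariantsRank_add_sum W κ hγ D n]
  exact selmerCorank_layer_le_lambdaInvariant_layerQuotient W κ hγ D n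

/-- ★★★ **`corank_{ℤ_p} Sel_{p^∞}(E_{K_n}/K_n) = rank_{ℤ_p} X/TX + ∑_{m<n} rank_{ℤ_p} X/Ψ_{m+1}X` as soon as `ker g_n` is finite.**
[cite: GreenbergLNM1716, Thm 1.2 and §1 p. 65] -/
theorem selmerCorank_layer_eq_coinvariantsRank_add_sum_of_finite_kerG (hγ : κ.IsTopGenerator γ) (D : W.SelmerDualData κ γ)
    [Module.Finite (IwasawaAlgebra p) D.X] (n : ℕ) [Finite (W.KerG κ n)] :
    (W.baseChange (κ.layer n)).selmerCorank p =
      IwasawaAlgebra.coinvariantsRank p D.X +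
        ∑ m ∈ Finset.range n, lambdaInvariant p (D.X ⧸ (Ideal.span
          {(∑ i ∈ Finset.range p, ((1 + PowerSeries.X : PowerSeries ℤ_[p]) ^ (p ^ m)) ^ i : IwasawaAlgebra p)} •
            ⊤ : Submodule (IwasawaAlgebra p) D.X)) := by
  rw [← lambdaInvariant_layerQuotient_eq_coinvariantsRank_add_sum W κ hγ D n]
  exact selmerCorank_layer_eq_lambdaInvariant_layerQuotient_of_finite_kerG W κ hγ D n

omit [W.IsElliptic] in
/-- ★★ **Each layer `m` with `rank_{ℤ_p} X/Ψ_{m+1}X > 0` contributes the prime `Ψ_{m+1} = Φ_{p^{m+1}}(1+T)` to `char_Λ X`** (`X` finitely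
generated torsion; `…SelmerLayerGrowthDichotomy` §1–§2): the nonzero summands of the budget are (pairwise non-associate) prime factors
of `f_X`. [cite: GreenbergLNM1716, §5 p. 132] [cite: Washington1997, §13.2] -/
theorem cyclotomicLayer_dvd_of_mem_charIdeal_of_summand_pos (D : W.SelmerDualData κ γ)
    [Module.Finite (IwasawaAlgebra p) D.X] (hD : D.IsTorsion) {m : ℕ}
    (hm : 0 < lambdaInvariant p (D.X ⧸ (Ideal.span
      {(∑ i ∈ Finset.range p, ((1 + PowerSeries.X : PowerSeries ℤ_[p]) ^ (p ^ m)) ^ i : IwasawaAlgebra p)} •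
        ⊤ : Submodule (IwasawaAlgebra p) D.X)))
    {g : IwasawaAlgebra p} (hg : g ∈ D.charIdeal) :
    (((cyclotomic (p ^ (m + 1)) ℤ_[p]).comp (Polynomial.X + 1) : ℤ_[p][X]) : PowerSeries ℤ_[p]) ∣ g :=
  cyclotomicLayer_dvd_of_mem_charIdeal_of_lambdaInvariant_cyclotomicFactor_pos W κ D hD m hm hg

/-- **Unconditional Selmer form**: if `corank Sel_{p^∞}(E_{K_n}/K_n) > rank_{ℤ_p} X/TX` then SOME layer `m < n` has `rank X/Ψ_{m+1}X > 0`,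
hence `Ψ_{m+1} ∣ char_Λ X` — a Selmer corank above the base coinvariant rank is paid for by a cyclotomic factor of `f_X`.
[cite: GreenbergLNM1716, §3 Lemma 3.1, §5 p. 132] -/
theorem exists_cyclotomicLayer_dvd_of_coinvariantsRank_lt_selmerCorank_layer (hγ : κ.IsTopGenerator γ) (D : W.SelmerDualData κ γ)
    [Module.Finite (IwasawaAlgebra p) D.X] (hD : D.IsTorsion) (n : ℕ)
    (h : IwasawaAlgebra.coinvariantsRank p D.X < (W.baseChange (κ.layer n)).selmerCorank p)
    {g : IwasawaAlgebra p} (hg : g ∈ D.charIdeal) :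
    ∃ m < n, (((cyclotomic (p ^ (m + 1)) ℤ_[p]).comp (Polynomial.X + 1) : ℤ_[p][X]) : PowerSeries ℤ_[p]) ∣ g := by
  have hle := selmerCorank_layer_le_coinvariantsRank_add_sum W κ hγ D n
  have hsum : 0 < ∑ m ∈ Finset.range n, lambdaInvariant p (D.X ⧸ (Ideal.span
      {(∑ i ∈ Finset.range p, ((1 + PowerSeries.X : PowerSeries ℤ_[p]) ^ (p ^ m)) ^ i : IwasawaAlgebra p)} •
        ⊤ : Submodule (IwasawaAlgebra p) D.X)) := by omega
  obtain ⟨m, hm, hne⟩ := Finset.exists_ne_zero_of_sum_ne_zero hsum.ne'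
  exact ⟨m, Finset.mem_range.mp hm,
    cyclotomicLayer_dvd_of_mem_charIdeal_of_summand_pos W κ D hD (Nat.pos_of_ne_zero hne) hg⟩

end Control

end Summit.BirchSwinnertonDyer.BirchSwinnertonDyer.Theorems.AlignedTransportAtTwoSelmerLayerBudget

end
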